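import Summits.Ventures.LatticeQCDFlow.Scaling.CrossCutFloorUniformR

/-!
HONEST FRAMING: exact (Metropolis-corrected) sampling algorithms for lattice gauge theory; figures
of merit are autocorrelation/cost numbers at stated couplings and volumes; no continuum-physics
claim.

# ClusteringFloorIffCrossCut — AT EVERY COUPLING `β > 0` THE CLUSTERING FLOOR (U″) IS EQUIVALENT
# TO THE CROSS-CUT FLOOR (U′) AT SEPARATION ONE (lean-1 GEN-11, ours; the conjecture ledger
# shrinks: (U″) at intermediate β ⇔ (U′) at `R = 0` at the same β)

Venture-side (OURS). Cell `lqcd-flow` (pub-lqcd), unit `pub-lqcd-lean-1-g11`, 2026-08-23.  The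
log-convexity half of the (U″) proof (`PlaquetteCorrelatorLogConvex`, `PlaquetteCorrelatorFloor`)
holds at EVERY `β ≥ 0` and on EVERY torus; only the input `g(1) ≥ δ` uniformly in `L` was taken
from the strong-coupling expansion.  Hence, for continuous `ρ`, `β > 0`, directions `i, j` and a
transverse axis `a ∉ {i, j}`:

* `crossCutCorrelatorFloor_perm`, `crossCutCorrelatorFloor_swap` — (U′) transports along axis
  permutations and orientation reversal exactly like (U″) (`ClusteringFloorAnyAxis`);
* `clusteringFloor_of_crossCut_transverse` — **(U′) at `R = 0` ⇒ (U″)** for every transverse axis;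
* **`clusteringFloor_iff_crossCut_zero`** — `ClusteringFloor d N G ρ β i j a ↔
  CrossCutCorrelatorFloor d N G ρ β 0 i j a`; and `clusteringFloor_iff_crossCut_all` —
  `… ↔ ∀ R, CrossCutCorrelatorFloor d N G ρ β R i j a`.

So THEORY-2's two volume-law hypotheses (U′) (every `R`) and (U″) are ONE conjecture at each
`β > 0`: a volume-uniform floor under the nearest-neighbour truncated plaquette correlator.
NOT CLAIMED: `a ∈ {i, j}`; `β ≤ 0`; any value of the floor at intermediate `β`.  [folklore]
mechanism (reflection positivity); new docking.
-/

noncomputable section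

namespace Summit.Ventures.LatticeQCDFlow.Theory2.Clustering

open MeasureTheory Literature.MathematicalPhysics.QuantumFieldTheory
open Summit.Ventures.LatticeQCDFlow.Conjectures

section Symmetry

variable {d N : ℕ} {G : Type} [Group G] [TopologicalSpace G] [IsTopologicalGroup G]
  [CompactSpace G] [MeasurableSpace G] [BorelSpace G] (ρ : G →* Matrix (Fin N) (Fin N) ℂ)

/-- **Axis permutations transport the cross-cut floor** (same `δ, L₀`). -/
theorem crossCutCorrelatorFloor_perm (hρ : Continuous ρ) {β : ℝ} {R : ℕ} {i j a : Fin d}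
    (π : Equiv.Perm (Fin d)) (h : CrossCutCorrelatorFloor d N G ρ β R i j a) :
    CrossCutCorrelatorFloor d N G ρ β R (π i) (π j) (π a) := by
  obtain ⟨δ, hδ, L₀, h⟩ := h
  refine ⟨δ, hδ, L₀, fun L _ hL x => ?_⟩
  have key := h L hL (sitePerm π.symm x)
  have hsh : sitePerm π.symm (x + Pi.single (π a) ((2 * R + 1 : ℕ) : ZMod L))
      = sitePerm π.symm x + Pi.single a ((2 * R + 1 : ℕ) : ZMod L) := by
    rw [sitePerm_add, sitePerm_single, Equiv.symm_apply_apply]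
  have e1 := wilsonExpectation_comp_configPerm ρ hρ β π (fun U : GaugeConfig d L G =>
    (ρ (plaquetteHolonomy U x (π i) (π j))).trace.re
      * (ρ (plaquetteHolonomy U (x + Pi.single (π a) ((2 * R + 1 : ℕ) : ZMod L))
          (π i) (π j))).trace.re)
  have e2 := wilsonExpectation_comp_configPerm ρ hρ β π (fun U : GaugeConfig d L G =>
    (ρ (plaquetteHolonomy U x (π i) (π j))).trace.re)
  have e3 := wilsonExpectation_comp_configPerm ρ hρ β π (fun U : GaugeConfig d L G =>
    (ρ (plaquetteHolonomy U (x + Pi.single (π a) ((2 * R + 1 : ℕ) : ZMod L)) (π i) (π j))).trace.re)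
  simp only [Function.comp_def, plaquetteHolonomy_configPerm, Equiv.symm_apply_apply, hsh] at e1 e2 e3
  rw [← e1, ← e2, ← e3]
  exact key

/-- **Orientation reversal transports the cross-cut floor.** -/
theorem crossCutCorrelatorFloor_swap (hρ : Continuous ρ) {β : ℝ} {R : ℕ} {i j a : Fin d}
    (h : CrossCutCorrelatorFloor d N G ρ β R i j a) : CrossCutCorrelatorFloor d N G ρ β R j i a := by
  obtain ⟨δ, hδ, L₀, h⟩ := h
  refine ⟨δ, hδ, L₀, fun L _ hL x => ?_⟩
  have hsw : ∀ (U : GaugeConfig d L G) (y : Site d L),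
      (ρ (plaquetteHolonomy U y j i)).trace.re = (ρ (plaquetteHolonomy U y i j)).trace.re :=
    fun U y => plaqObs_swap ρ hρ U y i j
  simp only [hsw]
  exact h L hL x

end Symmetry

section Equivalence

variable {d N : ℕ} [NeZero d] {G : Type} [Group G] [TopologicalSpace G] [IsTopologicalGroup G]
  [CompactSpace G] [MeasurableSpace G] [BorelSpace G] [SecondCountableTopology G]
  (ρ : G →* Matrix (Fin N) (Fin N) ℂ)

/-- **(U′) AT `R = 0` ⇒ (U″), FOR EVERY TRANSVERSE AXIS, AT EVERY `β > 0`.** -/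
theorem clusteringFloor_of_crossCut_transverse (hρ : Continuous ρ) {β : ℝ} (hβ : 0 < β)
    {i j a : Fin d} (hai : a ≠ i) (haj : a ≠ j)
    (hU : CrossCutCorrelatorFloor d N G ρ β 0 i j a) : ClusteringFloor d N G ρ β i j a := by
  set π : Equiv.Perm (Fin d) := Equiv.swap 0 a with hπ
  have hπ0 : π 0 = a := by simp [hπ]
  have hπa : π a = 0 := by simp [hπ]
  have hi0 : π i ≠ 0 := by
    intro h
    have : i = π.symm 0 := by rw [← h, Equiv.symm_apply_apply]
    rw [Equiv.symm_swap, Equiv.swap_apply_left] at this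
    exact hai this.symm
  have hj0 : π j ≠ 0 := by
    intro h
    have : j = π.symm 0 := by rw [← h, Equiv.symm_apply_apply]
    rw [Equiv.symm_swap, Equiv.swap_apply_left] at this
    exact haj this.symm
  have hππ : ∀ k, π (π k) = k := fun k => by simp [hπ, Equiv.swap_apply_self]
  -- move the hypothesis to the time axis, apply the time-direction theorem, move back
  have hU' : CrossCutCorrelatorFloor d N G ρ β 0 (π i) (π j) 0 := by
    have h := crossCutCorrelatorFloor_perm ρ hρ π hU
    rwa [hπa] at h
  have hcl : ClusteringFloor d N G ρ β (π i) (π j) 0 := clusteringFloor_of_crossCut ρ hρ hβ hi0 hj0 hU'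
  have h := clusteringFloor_perm ρ hρ π hcl
  rwa [hππ, hππ, hπ0] at h

/-- **(U″) ⇔ (U′) AT `R = 0`** at every `β > 0`, for continuous `ρ`, directions `i, j` and a
transverse axis `a ∉ {i, j}` (for `i = j` both sides speak about the trivial plaquette). -/
theorem clusteringFloor_iff_crossCut_zero (hρ : Continuous ρ) {β : ℝ} (hβ : 0 < β) {i j a : Fin d}
    (hai : a ≠ i) (haj : a ≠ j) :
    ClusteringFloor d N G ρ β i j a ↔ CrossCutCorrelatorFloor d N G ρ β 0 i j a :=
  ⟨fun h => crossCutCorrelatorFloor_of_clusteringFloor ρ h 0,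
    fun h => clusteringFloor_of_crossCut_transverse ρ hρ hβ hai haj h⟩

/-- **(U″) ⇔ (U′) FOR EVERY `R`** at every `β > 0` (transverse axis). -/
theorem clusteringFloor_iff_crossCut_all (hρ : Continuous ρ) {β : ℝ} (hβ : 0 < β) {i j a : Fin d}
    (hai : a ≠ i) (haj : a ≠ j) :
    ClusteringFloor d N G ρ β i j a ↔ ∀ R : ℕ, CrossCutCorrelatorFloor d N G ρ β R i j a :=
  ⟨fun h R => crossCutCorrelatorFloor_of_clusteringFloor ρ h R,
    fun h => clusteringFloor_of_crossCut_transverse ρ hρ hβ hai haj (h 0)⟩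

/-- The repaired forms: **(U′-R) at `R = 0` ⇒ (U″-R)** (transverse axis). -/
theorem clusteringFloorR_of_crossCutR_zero (hρ : Continuous ρ) {β : ℝ} {i j a : Fin d}
    (hai : a ≠ i) (haj : a ≠ j) (hU : CrossCutCorrelatorFloorR d N G ρ β 0 i j a) :
    ClusteringFloorR d N G ρ β i j a :=
  fun hd hij hβ hnt =>
    clusteringFloor_of_crossCut_transverse ρ hρ hβ hai haj (hU.floor hd hij hβ hnt)

end Equivalence

end Summit.Ventures.LatticeQCDFlow.Theory2.Clustering
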